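import Mathlib
import Literature.Probability.Percolation.DiagonalStripWheelSpace
import Literature.Combinatorics.Enumerative.SymplecticCharacterPolynomial
import HarnessLib

/-!
# IP12's symplectic character as a wheel polynomial in `U = z²` (Prop. 3.4, recursion (26))

Topic `Literature/Probability/Percolation`. Ikhlef–Ponsaing (J. Stat. Phys. 149 (2012),
arXiv:1202.5476) identify the sum of the qKZ ground state with the symplectic character
`χ_L(z_1², …, z_L²)` of their Def. 3.4 (Prop. 3.4) through the recursion (26) and the degree. This file
puts the character into the wheel space of `DiagonalStripWheelSpace`:

* `uCoeff`, `coeff_rapUni_eq`, `degreeOf_eq_natDegree_rapUni` — coefficients and degree in one variable;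
* `natDegree_leadingCoeff_rapUni_xAlt`, **`natDegree_leadingCoeff_rapUni_spS`** — the alternant and
  `S_{L+1}` as polynomials in `x_u`: degree `⌊L/2⌋`, leading coefficient `S_L(x_{u+1}, …)` (branching);
  hence `degreeOf_spS_le : deg_{x_n} S_L ≤ ⌊(L-1)/2⌋`;
* `uTransfer` — the transfer `x ↦ U + U⁻¹` cleared by `U^a` (`hom_uTransfer`, degrees, pair sums,
  window transpositions, palindromicity);
* `pairDeg_spS_le` — the `(x_u, x_{u+1})` pair sums of `S_{L+2}` are `≤ L` (two-row determinant bound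
  against the exact pair degree `2L + 1` of the Vandermonde denominator);
* **`uChar K u L := uTransfer (S_L)`** `= ∏ U_n^{a_L} · S_L(U + U⁻¹)`, `a_L = ⌊(L-1)/2⌋` — the numerator
  of `χ_L(z²)`; `eval_one_uChar : uChar(1⃗) = ipSpDim L`, `uChar_ne_zero`;
* **`eval₂Hom_xAlt_ipMu_wheel_eq_zero`** — the alternant of IP12's highest weights vanishes at the wheel
  point `U_{u+1} = ω U_u, U_k = ω² U_u` (three proportional rows after weighting by `w - w⁻¹`, since
  `3 ∤ ipMu`), while the denominator does not (`wPt_sub_ne_zero`);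
* **`uChar_isWheelPoly`** (`_odd`, `_even`) — `χ̂_L ∈ IsWheelPoly ω u L (2a_L) (2a_L + L - 2)`.

With `IsWheelPoly.proportional_odd/even` this yields IP12 Prop. 3.4 (`Z ∝ χ̂_L`) for any polynomial
solution of the right degree, and the recursion (26) with its exact constant (downstream).

## References

* Y. Ikhlef, A. K. Ponsaing, *Finite-size left-passage probability in percolation*, J. Stat. Phys.
  149 (2012) 10–36, arXiv:1202.5476, Def. 3.4, §3.6 (26), proof of Prop. 3.4, Prop. 4.7. [IkhlefPonsaing2012]
* W. Fulton, J. Harris, *Representation Theory*, GTM 129, Springer 1991, §24.2. [FultonHarris1991]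
-/

namespace Literature.Probability.Percolation

open Finset Literature.Probability.LatticeModels Literature.Probability.LatticeModels.TemperleyLieb

/-! ## Part F2b: IP12's symplectic character as a wheel polynomial -/

section XBranching

open MvPolynomial Literature.Combinatorics.Enumerative

variable {K₀ : Type*} [Field K₀]

variable (K₀) in
/-- **The coefficient of `X_i^d`** as a polynomial in the other variables. [folklore] -/
noncomputable def uCoeff (i d : ℕ) (F : MvPolynomial ℕ K₀) : MvPolynomial ℕ K₀ :=
  ∑ s ∈ F.support.filter (fun s => s i = d), monomial (s.erase i) (coeff s F)

/-- `uCoeff i d F` is free of `X_i`. [folklore] -/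
theorem degreeOf_uCoeff_self (i d : ℕ) (F : MvPolynomial ℕ K₀) : (uCoeff K₀ i d F).degreeOf i = 0 := by
  classical
  apply Nat.eq_zero_of_le_zero
  refine (degreeOf_sum_le i _ _).trans (Finset.sup_le fun s _ => ?_)
  by_cases h0 : coeff s F = 0
  · rw [h0, monomial_zero, degreeOf_zero]
  · rw [degreeOf_monomial_eq _ _ h0, Finsupp.erase_same]

/-- **The coefficients of `rapUni i F` are the images of the `uCoeff`.** [folklore] -/
theorem coeff_rapUni_eq (i : ℕ) (F : MvPolynomial ℕ K₀) (d : ℕ) : (rapUni K₀ i F).coeff d = toRF K₀ (uCoeff K₀ i d F) := by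
  classical
  conv_lhs => rw [F.as_sum, map_sum]
  rw [Polynomial.finsetSum_coeff, uCoeff, map_sum, Finset.sum_filter]
  refine Finset.sum_congr rfl fun s _ => ?_
  rw [rapUni_monomial, Polynomial.coeff_C_mul_X_pow]
  by_cases h : s i = d
  · rw [if_pos h.symm, if_pos h]
  · rw [if_neg (fun h' => h h'.symm), if_neg h]

/-- The coefficient of `uCoeff i d F` at `t` (with `t i = 0`) is the coefficient of `F` at `t + d e_i`. [folklore] -/
theorem coeff_uCoeff (i d : ℕ) (F : MvPolynomial ℕ K₀) (t : ℕ →₀ ℕ) (ht : t i = 0) :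
    coeff t (uCoeff K₀ i d F) = coeff (t + Finsupp.single i d) F := by
  classical
  rw [uCoeff, coeff_sum]
  have key : ∀ s : ℕ →₀ ℕ, s i = d → (s.erase i = t ↔ s = t + Finsupp.single i d) := fun s hsd => by
    constructor
    · intro he; ext n
      by_cases hn : n = i
      · subst hn; simp [hsd, ht]
      · have := congrArg (fun f : ℕ →₀ ℕ => f n) he
        simp only [Finsupp.erase_ne hn] at this
        simp [this, Ne.symm hn]
    · intro hs; subst hs; ext n
      by_cases hn : n = i
      · subst hn; simp [ht]
      · simp [Finsupp.erase_ne hn]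
  by_cases hmem : t + Finsupp.single i d ∈ F.support
  · rw [Finset.sum_eq_single (t + Finsupp.single i d)]
    · rw [coeff_monomial, if_pos]
      ext n; by_cases hn : n = i
      · subst hn; simp [ht]
      · simp [Finsupp.erase_ne hn]
    · intro s hs hne
      rw [coeff_monomial, if_neg]
      intro he
      exact hne ((key s (Finset.mem_filter.1 hs).2).1 he)
    · intro hn
      exact absurd (Finset.mem_filter.2 ⟨hmem, by simp [ht]⟩) hn
  · rw [notMem_support_iff.1 hmem]
    refine Finset.sum_eq_zero fun s hs => ?_
    rw [coeff_monomial, if_neg]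
    intro he
    exact hmem ((key s (Finset.mem_filter.1 hs).2).1 he ▸ (Finset.mem_filter.1 hs).1)

/-- **`deg_{X_u} F` is the degree of `rapUni u F`.** [folklore] -/
theorem degreeOf_eq_natDegree_rapUni (u : ℕ) (F : MvPolynomial ℕ K₀) : F.degreeOf u = (rapUni K₀ u F).natDegree := by
  classical
  refine le_antisymm ?_ (natDegree_rapUni_le u F)
  by_cases hF : F = 0
  · rw [hF, degreeOf_zero]; exact Nat.zero_le _
  -- a support element attaining the degree
  have hne : F.support.Nonempty := Finset.nonempty_of_ne_empty fun h => hF (support_eq_empty.1 h)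
  obtain ⟨s₀, hs₀, hs₀d⟩ := Finset.exists_mem_eq_sup F.support hne (fun s : ℕ →₀ ℕ => s u)
  rw [← degreeOf_eq_sup] at hs₀d
  -- the coefficient of `T^{deg}` is the image of a nonzero polynomial
  refine Polynomial.le_natDegree_of_ne_zero ?_
  rw [coeff_rapUni_eq]
  intro h0
  have h1 : uCoeff K₀ u (F.degreeOf u) F = 0 := toRF_injective (h0.trans (map_zero _).symm)
  have h2 := congrArg (coeff (s₀.erase u)) h1
  rw [coeff_uCoeff _ _ _ _ (Finsupp.erase_same), coeff_zero] at h2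
  have hs : s₀.erase u + Finsupp.single u (F.degreeOf u) = s₀ := by
    ext n; by_cases hn : n = u
    · subst hn; simp [hs₀d]
    · simp [Finsupp.erase_ne hn, Ne.symm hn]
  rw [hs] at h2
  exact (mem_support_iff.1 hs₀) h2

/-- `rapUni u` of the entry `E_d(x_u)` is the Chebyshev polynomial itself. [folklore] -/
theorem rapUni_xE_self (u d : ℕ) : rapUni K₀ u (xE K₀ u d) = chebE (RapidityField K₀) d := by
  rw [xE, Polynomial.aeval_def, MvPolynomial.algebraMap_eq, Polynomial.hom_eval₂, rapUni_X_self, ← chebE_map ((toRF K₀).comp C) d]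
  have hh : (rapUni K₀ u).comp C = Polynomial.C.comp ((toRF K₀).comp C) := by
    ext a
    · rw [RingHom.comp_apply, rapUni_C]; rfl
  rw [hh]
  rfl

/-- `rapUni u` of the Laplace expansion of the alternant along `x_u`. [folklore] -/
theorem rapUni_xAlt_succ (u L : ℕ) (e : ℕ → ℕ) :
    rapUni K₀ u (xAlt K₀ u (L + 1) e) = ∑ k : Fin (L + 1), (-1) ^ (k : ℕ) * chebE (RapidityField K₀) (e k - 1) *
      Polynomial.C (toRF K₀ (((xAltMat K₀ u (L + 1) e).submatrix Fin.succ k.succAbove).det)) := by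
  rw [xAlt_succ_eq_sum, map_sum]
  refine Finset.sum_congr rfl fun k _ => ?_
  rw [map_mul, map_mul, map_pow, map_neg, map_one, rapUni_xE_self, rapUni_eq_C_of_degreeOf_eq_zero (degreeOf_minor_eq_zero u L e k)]

/-- **Degree and leading coefficient of the alternant in `x_u`**: for a strictly increasing exponent
sequence `e ≥ 1` whose last minor is not zero, `rapUni u A_e` has degree `e_L - 1` and leading
coefficient `(-1)^L · (the alternant of the next window)`. [folklore] -/
theorem natDegree_leadingCoeff_rapUni_xAlt (u L : ℕ) {e : ℕ → ℕ} (he1 : ∀ k, 1 ≤ e k)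
    (hmono : ∀ k l, k < l → e k < e l) (hne : xAlt K₀ (u + 1) L e ≠ 0) :
    (rapUni K₀ u (xAlt K₀ u (L + 1) e)).natDegree = e L - 1 ∧
      (rapUni K₀ u (xAlt K₀ u (L + 1) e)).leadingCoeff = (-1) ^ L * toRF K₀ (xAlt K₀ (u + 1) L e) := by
  classical
  rw [rapUni_xAlt_succ, Fin.sum_univ_castSucc]
  simp only [Fin.val_castSucc, Fin.val_last]
  rw [xAltMat_submatrix_last, ← xAlt]
  set rest := ∑ k : Fin L, (-1) ^ (k : ℕ) * chebE (RapidityField K₀) (e k - 1) *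
      Polynomial.C (toRF K₀ (((xAltMat K₀ u (L + 1) e).submatrix Fin.succ (Fin.castSucc k).succAbove).det)) with hrest
  set c := toRF K₀ (xAlt K₀ (u + 1) L e) with hc
  have hc0 : c ≠ 0 := fun h => hne (toRF_injective (h.trans (map_zero _).symm))
  have hmonic := chebE_monic_natDegree (R := RapidityField K₀) (e L - 1)
  have hmain : ((-1 : Polynomial (RapidityField K₀)) ^ L * chebE (RapidityField K₀) (e L - 1) * Polynomial.C c)
      = Polynomial.C ((-1) ^ L * c) * chebE (RapidityField K₀) (e L - 1) := by
    rw [map_mul, map_pow, map_neg, map_one]; ring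
  have hcoef : ((-1 : RapidityField K₀) ^ L * c) ≠ 0 := mul_ne_zero (pow_ne_zero _ (neg_ne_zero.2 one_ne_zero)) hc0
  have hmain_deg : (Polynomial.C ((-1) ^ L * c) * chebE (RapidityField K₀) (e L - 1)).natDegree = e L - 1 := by
    rw [Polynomial.natDegree_C_mul hcoef, hmonic.2]
  have hmain_deg' : (Polynomial.C ((-1) ^ L * c) * chebE (RapidityField K₀) (e L - 1)).degree = ((e L - 1 : ℕ) : WithBot ℕ) := by
    rw [Polynomial.degree_eq_natDegree (mul_ne_zero (Polynomial.C_ne_zero.2 hcoef) hmonic.1.ne_zero), hmain_deg]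
  have hmain_lc : (Polynomial.C ((-1) ^ L * c) * chebE (RapidityField K₀) (e L - 1)).leadingCoeff = (-1) ^ L * c := by
    rw [Polynomial.leadingCoeff_mul, Polynomial.leadingCoeff_C, hmonic.1.leadingCoeff, mul_one]
  have hrest_deg : rest.degree < ((e L - 1 : ℕ) : WithBot ℕ) := by
    rw [hrest]
    refine (Polynomial.degree_sum_le _ _).trans_lt ((Finset.sup_lt_iff (WithBot.bot_lt_coe _)).2 fun k _ => ?_)
    have hk : e k - 1 < e L - 1 := by
      have := hmono k L k.2
      have := he1 k
      omega
    refine lt_of_le_of_lt ?_ (WithBot.coe_lt_coe.2 hk)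
    have h1 : ((-1 : Polynomial (RapidityField K₀)) ^ (k : ℕ)).degree ≤ 0 := by
      rw [show ((-1 : Polynomial (RapidityField K₀)) ^ (k : ℕ)) = Polynomial.C ((-1) ^ (k : ℕ)) by
        rw [map_pow, map_neg, map_one]]
      exact Polynomial.degree_C_le
    have h2 : (chebE (RapidityField K₀) (e k - 1)).degree ≤ ((e k - 1 : ℕ) : WithBot ℕ) :=
      Polynomial.degree_le_of_natDegree_le (chebE_monic_natDegree (R := RapidityField K₀) (e k - 1)).2.le
    have h3 : (Polynomial.C (toRF K₀ (((xAltMat K₀ u (L + 1) e).submatrix Fin.succ (Fin.castSucc k).succAbove).det)) :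
        Polynomial (RapidityField K₀)).degree ≤ 0 := Polynomial.degree_C_le
    calc _ ≤ ((-1 : Polynomial (RapidityField K₀)) ^ (k : ℕ) * chebE (RapidityField K₀) (e k - 1)).degree + _ :=
          Polynomial.degree_mul_le _ _
      _ ≤ (((-1 : Polynomial (RapidityField K₀)) ^ (k : ℕ)).degree + (chebE (RapidityField K₀) (e k - 1)).degree) + 0 :=
          add_le_add (Polynomial.degree_mul_le _ _) h3
      _ ≤ (0 + ((e k - 1 : ℕ) : WithBot ℕ)) + 0 := add_le_add (add_le_add h1 h2) le_rfl
      _ = ((e k - 1 : ℕ) : WithBot ℕ) := by simp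
  rw [hmain]
  exact ⟨(Polynomial.natDegree_add_eq_right_of_degree_lt (hmain_deg' ▸ hrest_deg)).trans hmain_deg,
    (Polynomial.leadingCoeff_add_of_degree_lt (hmain_deg' ▸ hrest_deg)).trans hmain_lc⟩

end XBranching

section SBranching

open MvPolynomial Literature.Combinatorics.Enumerative

variable {K₀ : Type*} [Field K₀] [CharZero K₀]

/-- **Branching of `S_L` in `x_u`**: as a polynomial in `x_u`, `S_{L+1}(x_u, …, x_{u+L})` has degree
`ipMu L - 1 - L = ⌊L/2⌋` and leading coefficient `S_L(x_{u+1}, …, x_{u+L})` (the branching rule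
`Sp(2L+2) ↓ Sp(2L)` for IP12's highest weights, top component). [cite: IkhlefPonsaing2012, Def. 3.4, (26)] -/
theorem natDegree_leadingCoeff_rapUni_spS (u L : ℕ) :
    (rapUni K₀ u (spS K₀ u (L + 1))).natDegree = ipMu L - 1 - L ∧
      (rapUni K₀ u (spS K₀ u (L + 1))).leadingCoeff = toRF K₀ (spS K₀ (u + 1) L) := by
  have hμ1 : ∀ k, 1 ≤ ipMu k := fun k => by unfold ipMu; omega
  obtain ⟨hdA, hlA⟩ := natDegree_leadingCoeff_rapUni_xAlt (K₀ := K₀) u L hμ1 (fun k l h => ipMu_lt_ipMu h)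
    (xAlt_ipMu_ne_zero (u + 1) L)
  obtain ⟨hdV, hlV⟩ := natDegree_leadingCoeff_rapUni_xAlt (K₀ := K₀) u L (e := (· + 1)) (fun k => by omega)
    (fun k l h => by omega) (xAlt_succ_ne_zero (u + 1) L)
  have hid := congrArg (rapUni K₀ u) (xAlt_ipMu_eq (K := K₀) u (L + 1))
  rw [map_mul] at hid
  have hV0 : rapUni K₀ u (xAlt K₀ u (L + 1) (· + 1)) ≠ 0 := fun h =>
    xAlt_succ_ne_zero (K := K₀) u (L + 1) (rapUni_injective u (h.trans (map_zero _).symm))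
  have hS0 : rapUni K₀ u (spS K₀ u (L + 1)) ≠ 0 := fun h =>
    spS_ne_zero (K := K₀) u (L + 1) (rapUni_injective u (h.trans (map_zero _).symm))
  constructor
  · have := congrArg Polynomial.natDegree hid
    rw [Polynomial.natDegree_mul hV0 hS0, hdA, hdV] at this
    simp only [Nat.add_sub_cancel] at this ⊢
    omega
  · have := congrArg Polynomial.leadingCoeff hid
    rw [Polynomial.leadingCoeff_mul, hlA, hlV, xAlt_ipMu_eq, map_mul] at this
    simp only [mul_assoc] at this
    simp only [← mul_assoc] at this
    have hc : ((-1 : RapidityField K₀) ^ L * toRF K₀ (xAlt K₀ (u + 1) L (· + 1))) ≠ 0 :=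
      mul_ne_zero (pow_ne_zero _ (neg_ne_zero.2 one_ne_zero))
        (fun h => xAlt_succ_ne_zero (K := K₀) (u + 1) L (toRF_injective (h.trans (map_zero _).symm)))
    exact (mul_left_cancel₀ hc this).symm

/-- **`deg_{x_u} S_{L+1} = ⌊L/2⌋`.** [folklore] -/
theorem degreeOf_spS_self (u L : ℕ) : (spS K₀ u (L + 1)).degreeOf u = L / 2 := by
  rw [degreeOf_eq_natDegree_rapUni, (natDegree_leadingCoeff_rapUni_spS u L).1]
  unfold ipMu; omega

/-- **`deg_{x_n} S_L ≤ ⌊(L-1)/2⌋` for every `n`.** [folklore] -/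
theorem degreeOf_spS_le (u L n : ℕ) : (spS K₀ u L).degreeOf n ≤ (L - 1) / 2 := by
  by_cases hn : u ≤ n ∧ n < u + L
  · obtain ⟨L', rfl⟩ : ∃ L', L = L' + 1 := ⟨L - 1, by omega⟩
    have hsymm := rename_swap_spS' (K := K₀) u (L' + 1) (a := u) (b := n) le_rfl (by omega) hn.1 hn.2
    have := degreeOf_rename_of_injective (Equiv.injective (Equiv.swap u n)) u (p := spS K₀ u (L' + 1))
    rw [hsymm, Equiv.swap_apply_left] at this
    rw [this, degreeOf_spS_self]
    simp
  · rw [degreeOf_spS_eq_zero u L (by omega)]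
    exact Nat.zero_le _

end SBranching

/-! ### The transfer `x = U + U⁻¹` cleared by `U^a` -/

section Transfer

open MvPolynomial

variable {K₀ : Type*} [Field K₀]

/-- `pairDeg` of zero. [folklore] -/
theorem pairDeg_zero (a b : ℕ) : pairDeg a b (0 : MvPolynomial ℕ K₀) = 0 := by
  rw [pairDeg, support_zero, Finset.sup_empty, bot_eq_zero]

/-- `pairDeg` of a sum. [folklore] -/
theorem pairDeg_add_le (a b : ℕ) (f g : MvPolynomial ℕ K₀) : pairDeg a b (f + g) ≤ max (pairDeg a b f) (pairDeg a b g) := by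
  classical
  refine pairDeg_le_iff.2 fun s hs => ?_
  rcases Finset.mem_union.1 (support_add hs) with h | h
  · exact (le_pairDeg h).trans (le_max_left _ _)
  · exact (le_pairDeg h).trans (le_max_right _ _)

/-- `pairDeg` of a finite sum. [folklore] -/
theorem pairDeg_sum_le {ι : Type*} (a b : ℕ) (s : Finset ι) (f : ι → MvPolynomial ℕ K₀) (B : ℕ)
    (h : ∀ i ∈ s, pairDeg a b (f i) ≤ B) : pairDeg a b (∑ i ∈ s, f i) ≤ B := by
  classical
  induction s using Finset.induction_on with
  | empty => rw [Finset.sum_empty, pairDeg_zero]; exact Nat.zero_le _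
  | insert i s hi ih =>
    rw [Finset.sum_insert hi]
    exact (pairDeg_add_le _ _ _ _).trans (max_le (h i (Finset.mem_insert_self _ _))
      (ih fun k hk => h k (Finset.mem_insert_of_mem hk)))

/-- `pairDeg` of a product (inequality form). [folklore] -/
theorem pairDeg_mul_le {a b : ℕ} (hab : a ≠ b) (f g : MvPolynomial ℕ K₀) : pairDeg a b (f * g) ≤ pairDeg a b f + pairDeg a b g := by
  by_cases hf : f = 0
  · rw [hf, zero_mul, pairDeg_zero]; exact Nat.zero_le _
  by_cases hg : g = 0
  · rw [hg, mul_zero, pairDeg_zero]; exact Nat.zero_le _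
  rw [pairDeg_mul hab hf hg]

/-- The variable degrees of `aeval g P` for a one-variable `P`. [folklore] -/
theorem degreeOf_polynomial_aeval_le (g : MvPolynomial ℕ K₀) (P : Polynomial K₀) (n : ℕ) :
    (Polynomial.aeval g P).degreeOf n ≤ P.natDegree * g.degreeOf n := by
  classical
  rw [Polynomial.aeval_eq_sum_range]
  refine (degreeOf_sum_le _ _ _).trans (Finset.sup_le fun k hk => ?_)
  rw [MvPolynomial.smul_eq_C_mul]
  refine (degreeOf_C_mul_le _ _ _).trans ((degreeOf_pow_le _ _ _).trans ?_)
  exact Nat.mul_le_mul_right _ (by have := Finset.mem_range.1 hk; omega)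

variable (K₀) in
/-- **The transfer** `x^s ↦ ∏_{n ∈ window} (U_n² + 1)^{s_n} U_n^{a - s_n}`: for a polynomial `p` in the
variables `x_n`, `n ∈ [u, u+L)`, of degree `≤ a` in each, `uTransfer p = ∏ U_n^a · p(U + U⁻¹)`.
[cite: IkhlefPonsaing2012, Prop. 3.4 (`χ_L(z_1², …, z_L²)`)] -/
noncomputable def uTransfer (u L a : ℕ) (p : MvPolynomial ℕ K₀) : MvPolynomial ℕ K₀ :=
  ∑ s ∈ p.support, C (coeff s p) * ∏ n ∈ Finset.Ico u (u + L), ((X n ^ 2 + 1) ^ s n * X n ^ (a - s n))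

/-- Support exponents are bounded by the variable degrees (window form). [folklore] -/
theorem supp_le_of_degreeOf {p : MvPolynomial ℕ K₀} {u L a : ℕ} (hdeg : ∀ n ∈ Finset.Ico u (u + L), p.degreeOf n ≤ a)
    (hvars : ∀ n ∉ Finset.Ico u (u + L), p.degreeOf n = 0) {s : ℕ →₀ ℕ} (hs : s ∈ p.support) :
    (∀ n ∈ Finset.Ico u (u + L), s n ≤ a) ∧ s.support ⊆ Finset.Ico u (u + L) := by
  refine ⟨fun n hn => (monomial_le_degreeOf n hs).trans (hdeg n hn), fun n hn => ?_⟩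
  by_contra hnw
  have := (monomial_le_degreeOf n hs).trans (hvars n hnw).le
  exact (Finsupp.mem_support_iff.1 hn) (Nat.eq_zero_of_le_zero this)

/-- **The transfer through a homomorphism into a field**: `φ(uTransfer p) = ∏ φ(U_n)^a · p(φ(U) + φ(U)⁻¹)`.
[folklore] -/
theorem hom_uTransfer {S : Type*} [Field S] (φ : MvPolynomial ℕ K₀ →+* S) {u L a : ℕ}
    (hφ : ∀ n ∈ Finset.Ico u (u + L), φ (X n) ≠ 0) {p : MvPolynomial ℕ K₀}
    (hdeg : ∀ n ∈ Finset.Ico u (u + L), p.degreeOf n ≤ a) (hvars : ∀ n ∉ Finset.Ico u (u + L), p.degreeOf n = 0) :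
    φ (uTransfer K₀ u L a p) = (∏ n ∈ Finset.Ico u (u + L), φ (X n) ^ a) *
      eval₂ (φ.comp C) (fun n => φ (X n) + (φ (X n))⁻¹) p := by
  classical
  rw [uTransfer, map_sum, eval₂_eq, Finset.mul_sum]
  refine Finset.sum_congr rfl fun s hs => ?_
  obtain ⟨hsa, hsupp⟩ := supp_le_of_degreeOf hdeg hvars hs
  rw [map_mul, RingHom.comp_apply, mul_left_comm, map_prod]
  congr 1
  rw [Finset.prod_subset hsupp (fun n _ hn => by rw [Finsupp.notMem_support_iff.1 hn, pow_zero]), ← Finset.prod_mul_distrib]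
  refine Finset.prod_congr rfl fun n hn => ?_
  have h0 := hφ n hn
  rw [map_mul, map_pow, map_pow, map_add, map_pow, map_one]
  have e1 : φ (X n) ^ a = φ (X n) ^ (a - s n) * φ (X n) ^ s n := by rw [← pow_add, Nat.sub_add_cancel (hsa n hn)]
  rw [e1, mul_assoc, ← mul_pow, mul_add, mul_inv_cancel₀ h0, ← sq]
  ring

/-- **Variable degrees of the transfer**: `≤ 2a` on the window, `0` outside. [folklore] -/
theorem degreeOf_uTransfer_le {p : MvPolynomial ℕ K₀} {u L a : ℕ} (hdeg : ∀ n ∈ Finset.Ico u (u + L), p.degreeOf n ≤ a)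
    (hvars : ∀ n ∉ Finset.Ico u (u + L), p.degreeOf n = 0) (n : ℕ) :
    (uTransfer K₀ u L a p).degreeOf n ≤ if n ∈ Finset.Ico u (u + L) then a + p.degreeOf n else 0 := by
  classical
  rw [uTransfer]
  refine (degreeOf_sum_le _ _ _).trans (Finset.sup_le fun s hs => ?_)
  obtain ⟨hsa, -⟩ := supp_le_of_degreeOf hdeg hvars hs
  refine (degreeOf_C_mul_le _ _ _).trans ((degreeOf_prod_le _ _ _).trans ?_)
  have hterm : ∀ k ∈ Finset.Ico u (u + L), ((X k ^ 2 + 1) ^ s k * X k ^ (a - s k) : MvPolynomial ℕ K₀).degreeOf n ≤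
      if k = n then a + s n else 0 := fun k hk => by
    refine (degreeOf_mul_le _ _ _).trans ?_
    have h1 : ((X k ^ 2 + 1 : MvPolynomial ℕ K₀) ^ s k).degreeOf n ≤ if k = n then 2 * s n else 0 := by
      refine (degreeOf_pow_le _ _ _).trans ?_
      have : (X k ^ 2 + 1 : MvPolynomial ℕ K₀).degreeOf n ≤ if k = n then 2 else 0 := by
        refine (degreeOf_add_le _ _ _).trans (max_le ?_ ?_)
        · rw [degreeOf_pow_eq _ _ _ (X_ne_zero _), degreeOf_X]
          split_ifs <;> omega
        · rw [degreeOf_one]; exact Nat.zero_le _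
      split_ifs with hkn
      · subst hkn; rw [if_pos rfl] at this
        calc s k * (X k ^ 2 + 1 : MvPolynomial ℕ K₀).degreeOf k ≤ s k * 2 := Nat.mul_le_mul_left _ this
          _ = 2 * s k := by ring
      · rw [if_neg hkn] at this
        rw [Nat.eq_zero_of_le_zero this, mul_zero]
    have h2 : ((X k : MvPolynomial ℕ K₀) ^ (a - s k)).degreeOf n = if k = n then a - s n else 0 := by
      rw [degreeOf_pow_eq _ _ _ (X_ne_zero _), degreeOf_X]
      by_cases hkn : k = n
      · subst hkn; rw [if_pos rfl, if_pos rfl, mul_one]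
      · rw [if_neg hkn, if_neg (Ne.symm hkn), mul_zero]
    rw [h2]
    split_ifs with hkn
    · subst hkn; rw [if_pos rfl] at h1
      have := hsa k hk
      omega
    · rw [if_neg hkn] at h1; omega
  calc ∑ k ∈ Finset.Ico u (u + L), ((X k ^ 2 + 1) ^ s k * X k ^ (a - s k) : MvPolynomial ℕ K₀).degreeOf n
      ≤ ∑ k ∈ Finset.Ico u (u + L), (if k = n then a + s n else 0) := Finset.sum_le_sum hterm
    _ = if n ∈ Finset.Ico u (u + L) then a + s n else 0 := by rw [Finset.sum_ite_eq']
    _ ≤ _ := by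
      split_ifs with hn
      · exact Nat.add_le_add_left (monomial_le_degreeOf n hs) _
      · exact le_rfl

/-- **Pair sums of the transfer**: `≤ 2a + (pair sums of p)`. [folklore] -/
theorem pairDeg_uTransfer_le {p : MvPolynomial ℕ K₀} {u L a : ℕ} (hdeg : ∀ n ∈ Finset.Ico u (u + L), p.degreeOf n ≤ a)
    (hvars : ∀ n ∉ Finset.Ico u (u + L), p.degreeOf n = 0) (i j : ℕ) :
    pairDeg i j (uTransfer K₀ u L a p) ≤ 2 * a + pairDeg i j p := by
  classical
  rw [uTransfer]
  refine pairDeg_sum_le _ _ _ _ _ fun s hs => ?_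
  -- the term of `s` is the transfer of the monomial `x^s`
  have hmono : C (coeff s p) * ∏ n ∈ Finset.Ico u (u + L), ((X n ^ 2 + 1) ^ s n * X n ^ (a - s n)) =
      uTransfer K₀ u L a (monomial s (coeff s p)) := by
    rw [uTransfer, support_monomial, if_neg (mem_support_iff.1 hs), Finset.sum_singleton, coeff_monomial, if_pos rfl]
  obtain ⟨hsa, hsupp⟩ := supp_le_of_degreeOf hdeg hvars hs
  have hdeg' : ∀ n ∈ Finset.Ico u (u + L), (monomial s (coeff s p)).degreeOf n ≤ a := fun n hn => by
    rw [degreeOf_monomial_eq _ _ (mem_support_iff.1 hs)]; exact hsa n hn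
  have hvars' : ∀ n ∉ Finset.Ico u (u + L), (monomial s (coeff s p)).degreeOf n = 0 := fun n hn => by
    rw [degreeOf_monomial_eq _ _ (mem_support_iff.1 hs)]
    by_contra h; exact hn (hsupp (Finsupp.mem_support_iff.2 h))
  rw [hmono]
  refine (pairDeg_le_degreeOf_add _ _ _).trans ?_
  have hi := degreeOf_uTransfer_le (K₀ := K₀) hdeg' hvars' i
  have hj := degreeOf_uTransfer_le (K₀ := K₀) hdeg' hvars' j
  have hsi : (monomial s (coeff s p)).degreeOf i = s i := by rw [degreeOf_monomial_eq _ _ (mem_support_iff.1 hs)]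
  have hsj : (monomial s (coeff s p)).degreeOf j = s j := by rw [degreeOf_monomial_eq _ _ (mem_support_iff.1 hs)]
  rw [hsi] at hi; rw [hsj] at hj
  have hs2 := le_pairDeg (a := i) (b := j) hs
  split_ifs at hi hj <;> omega

/-- **The transfer commutes with window transpositions.** [folklore] -/
theorem rename_swap_uTransfer {u L a : ℕ} {c d : ℕ} (hc : c ∈ Finset.Ico u (u + L)) (hd : d ∈ Finset.Ico u (u + L))
    (p : MvPolynomial ℕ K₀) :
    rename (Equiv.swap c d) (uTransfer K₀ u L a p) = uTransfer K₀ u L a (rename (Equiv.swap c d) p) := by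
  classical
  set σ : Equiv.Perm ℕ := Equiv.swap c d with hσ
  have hinj : Function.Injective (Finsupp.mapDomain σ : (ℕ →₀ ℕ) → (ℕ →₀ ℕ)) := Finsupp.mapDomain_injective σ.injective
  rw [uTransfer, uTransfer, map_sum, support_rename_of_injective σ.injective, Finset.sum_image (fun s _ t _ h => hinj h)]
  refine Finset.sum_congr rfl fun s _ => ?_
  rw [map_mul, rename_C, coeff_rename_mapDomain σ σ.injective, map_prod]
  congr 1
  -- reindex the window product by `σ`
  have hperm : ∀ f : ℕ → MvPolynomial ℕ K₀, ∏ n ∈ Finset.Ico u (u + L), f (σ n) = ∏ n ∈ Finset.Ico u (u + L), f n :=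
    fun f => Equiv.Perm.prod_comp σ _ f fun n hn => by
      simp only [Set.mem_setOf_eq, hσ] at hn
      rcases eq_or_ne n c with rfl | hnc
      · exact hc
      · rcases eq_or_ne n d with rfl | hnd
        · exact hd
        · exact absurd (Equiv.swap_apply_of_ne_of_ne hnc hnd) hn
  conv_rhs => rw [← hperm]
  refine Finset.prod_congr rfl fun n _ => ?_
  simp only [map_mul, map_pow, map_add, map_one, rename_X, Finsupp.mapDomain_apply σ.injective]

/-- `ι_n` fixes `p(z + z⁻¹)`. [folklore] -/
theorem genInv_eval₂_symm (n : ℕ) (p : MvPolynomial ℕ K₀) :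
    genInv K₀ n (eval₂ ((toRF K₀).comp C) (fun k => genZ K₀ k + (genZ K₀ k)⁻¹) p) =
      eval₂ ((toRF K₀).comp C) (fun k => genZ K₀ k + (genZ K₀ k)⁻¹) p := by
  rw [← coe_eval₂Hom, ← RingHom.comp_apply]
  congr 1
  refine ringHom_ext (fun a => ?_) (fun k => ?_)
  · rw [RingHom.comp_apply, eval₂Hom_C, RingHom.comp_apply]; exact genInv_genC n a
  · rw [RingHom.comp_apply, eval₂Hom_X', map_add, map_inv₀, genInv_genZ]
    by_cases hk : k = n
    · subst hk; rw [Function.update_self, inv_inv, add_comm]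
    · rw [Function.update_of_ne hk]

/-- **The transfer is palindromic of formal degree `2a`** in every window variable (field form). [folklore] -/
theorem genInv_uTransfer {p : MvPolynomial ℕ K₀} {u L a : ℕ} (hdeg : ∀ n ∈ Finset.Ico u (u + L), p.degreeOf n ≤ a)
    (hvars : ∀ n ∉ Finset.Ico u (u + L), p.degreeOf n = 0) {n : ℕ} (hn : n ∈ Finset.Ico u (u + L)) :
    genInv K₀ n (toRF K₀ (uTransfer K₀ u L a p)) * genZ K₀ n ^ (2 * a) = toRF K₀ (uTransfer K₀ u L a p) := by
  classical
  have hz : ∀ k, toRF K₀ (X k) = genZ K₀ k := fun k => rfl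
  rw [hom_uTransfer (toRF K₀) (fun k _ => by rw [hz]; exact genZ_ne_zero k) hdeg hvars]
  simp only [hz]
  rw [map_mul, genInv_eval₂_symm, map_prod, mul_right_comm]
  congr 1
  rw [← Finset.mul_prod_erase _ _ hn, ← Finset.mul_prod_erase _ (fun k => genZ K₀ k ^ a) hn, map_pow, genInv_genZ,
    Function.update_self, mul_right_comm]
  congr 1
  · rw [inv_pow, ← zpow_natCast, ← zpow_natCast, ← zpow_neg, ← zpow_add₀ (genZ_ne_zero n)]
    congr 1; push_cast; ring
  · refine Finset.prod_congr rfl fun k hk => ?_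
    rw [map_pow, genInv_genZ, Function.update_of_ne (Finset.mem_erase.1 hk).1]

end Transfer

/-! ### The pair bound of `S_L` at `(x_u, x_{u+1})` -/

section SPair

open MvPolynomial Literature.Combinatorics.Enumerative

variable {K₀ : Type*} [Field K₀]

/-- **Two-row degree bound for a determinant**: if only the rows `r₁ ≠ r₂` involve `X_n`, with column
degrees `≤ d k`, and `d k₁ + d k₂ ≤ D` for distinct columns, then `deg_{X_n} det ≤ D`. [folklore] -/
theorem degreeOf_det_le_two_rows {L : ℕ} (M : Matrix (Fin L) (Fin L) (MvPolynomial ℕ K₀)) (n : ℕ) {r₁ r₂ : Fin L}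
    (hr : r₁ ≠ r₂) (d : Fin L → ℕ) (hM : ∀ r k, (M r k).degreeOf n ≤ if r = r₁ ∨ r = r₂ then d k else 0) {D : ℕ}
    (hd : ∀ k₁ k₂, k₁ ≠ k₂ → d k₁ + d k₂ ≤ D) : M.det.degreeOf n ≤ D := by
  classical
  rw [Matrix.det_apply]
  refine (degreeOf_sum_le _ _ _).trans (Finset.sup_le fun σ _ => ?_)
  have hsmul : ∀ f : MvPolynomial ℕ K₀, (Equiv.Perm.sign σ • f).degreeOf n = f.degreeOf n := fun f => by
    rcases Int.units_eq_one_or (Equiv.Perm.sign σ) with hs | hs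
    · rw [hs, one_smul]
    · rw [hs, Units.neg_smul, one_smul, degreeOf_neg]
  rw [hsmul]
  refine (degreeOf_prod_le _ _ _).trans ?_
  set T : Finset (Fin L) := {σ.symm r₁, σ.symm r₂} with hT
  have hT2 : σ.symm r₁ ≠ σ.symm r₂ := fun h => hr (σ.symm.injective h)
  calc ∑ k, (M (σ k) k).degreeOf n ≤ ∑ k, (if k ∈ T then d k else 0) := Finset.sum_le_sum fun k _ => by
          refine (hM _ _).trans ?_
          by_cases hk : k ∈ T
          · rw [if_pos hk]; split_ifs <;> omega
          · rw [if_neg hk, if_neg]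
            simp only [hT, Finset.mem_insert, Finset.mem_singleton, not_or] at hk
            rintro (h | h)
            · exact hk.1 (by rw [← h, Equiv.symm_apply_apply])
            · exact hk.2 (by rw [← h, Equiv.symm_apply_apply])
    _ = ∑ k ∈ T, d k := by rw [← Finset.sum_filter, Finset.filter_mem_eq_inter, Finset.univ_inter]
    _ = d (σ.symm r₁) + d (σ.symm r₂) := Finset.sum_pair hT2
    _ ≤ D := hd _ _ hT2

/-- `pairMap` through the alternant. [folklore] -/
theorem pairMap_xAlt (a b u L : ℕ) (e : ℕ → ℕ) :
    pairMap K₀ a b (xAlt K₀ u L e) = (Matrix.of fun i k : Fin L =>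
      Polynomial.aeval (pairMap K₀ a b (X (u + i))) (chebE K₀ (e k - 1))).det :=
  algHom_xAlt _ u L e

/-- **The `(x_u, x_{u+1})` pair degree of an alternant** is at most `(e_{L+1} - 1) + (e_L - 1)` (for
`L + 2` variables and an increasing exponent sequence). [folklore] -/
theorem pairDeg_xAlt_le (u L : ℕ) {e : ℕ → ℕ} (hmono : ∀ k l, k ≤ l → e k ≤ e l) :
    pairDeg u (u + 1) (xAlt K₀ u (L + 2) e) ≤ (e (L + 1) - 1) + (e L - 1) := by
  rw [← degreeOf_pairMap (show u ≠ u + 1 by omega), pairMap_xAlt]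
  refine degreeOf_det_le_two_rows _ u (r₁ := ⟨0, by omega⟩) (r₂ := ⟨1, by omega⟩) (by simp)
    (fun k => e k - 1) (fun r k => ?_) (fun k₁ k₂ hk => ?_)
  · simp only [Matrix.of_apply]
    refine (degreeOf_polynomial_aeval_le _ _ _).trans ?_
    rw [(chebE_monic_natDegree (R := K₀) (e k - 1)).2, pairMap_X]
    have hr : (r = ⟨0, by omega⟩ ∨ r = ⟨1, by omega⟩) ↔ (r : ℕ) ≤ 1 := by
      simp only [Fin.ext_iff]; omega
    by_cases hr1 : (r : ℕ) ≤ 1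
    · rw [if_pos (hr.2 hr1)]
      refine (Nat.mul_le_mul_left _ (show (if u + (r : ℕ) = u + 1 then X u * X (u + 1) else X (u + (r : ℕ)) :
        MvPolynomial ℕ K₀).degreeOf u ≤ 1 from ?_)).trans (by simp)
      split_ifs
      · rw [degreeOf_mul_eq (X_ne_zero _) (X_ne_zero _), degreeOf_X, degreeOf_X, if_pos rfl, if_neg (by omega)]
      · rw [degreeOf_X]; split_ifs <;> simp
    · rw [if_neg (fun h => hr1 (hr.1 h)), if_neg (show u + (r : ℕ) ≠ u + 1 by omega), degreeOf_X,
        if_neg (show u ≠ u + (r : ℕ) by omega), mul_zero]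
  · -- two distinct columns: `e k₁ + e k₂ ≤ e (L+1) + e L`
    have h1 : ∀ k : Fin (L + 2), e k - 1 ≤ e (L + 1) - 1 := fun k => Nat.sub_le_sub_right (hmono _ _ (by omega)) _
    rcases lt_or_gt_of_ne hk with h | h
    · have : e k₁ - 1 ≤ e L - 1 := Nat.sub_le_sub_right (hmono _ _ (by have := Fin.lt_def.1 h; omega)) _
      have := h1 k₂; omega
    · have : e k₂ - 1 ≤ e L - 1 := Nat.sub_le_sub_right (hmono _ _ (by have := Fin.lt_def.1 h; omega)) _
      have := h1 k₁; omega

/-- `z_k ≠ 1`. [folklore] -/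
theorem genZ_ne_one (k : ℕ) : genZ K₀ k ≠ 1 := fun h => by
  have : (X k : MvPolynomial ℕ K₀) = 1 := toRF_injective (by rw [map_one]; exact h)
  have := congrArg (degreeOf k) this
  rw [degreeOf_X, if_pos rfl, degreeOf_one] at this
  exact one_ne_zero this

/-- The factors of the Vandermonde product after `x_{u+1} ↦ x_u x_{u+1}`, as polynomials in `x_u`:
degree `1` if the factor involves `x_u` or `x_{u+1}`, else `0`. [folklore] -/
theorem natDegree_rapUni_pairMap_factor (u : ℕ) {r k : ℕ} (hrk : r < k) :
    rapUni K₀ u (pairMap K₀ u (u + 1) (X (u + k) - X (u + r))) ≠ 0 ∧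
      (rapUni K₀ u (pairMap K₀ u (u + 1) (X (u + k) - X (u + r)))).natDegree = if r ≤ 1 then 1 else 0 := by
  have hk : pairMap K₀ u (u + 1) (X (u + k)) = if k = 1 then X u * X (u + 1) else X (u + k) := by
    rw [pairMap_X]; by_cases h : k = 1
    · subst h; rw [if_pos rfl, if_pos rfl]
    · rw [if_neg (by omega), if_neg h]
  have hr : pairMap K₀ u (u + 1) (X (u + r)) = if r = 1 then X u * X (u + 1) else X (u + r) := by
    rw [pairMap_X]; by_cases h : r = 1
    · subst h; rw [if_pos rfl, if_pos rfl]
    · rw [if_neg (by omega), if_neg h]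
  have hz1 : genZ K₀ (u + 1) ≠ 0 := genZ_ne_zero _
  have coeff1 : ∀ (a b : RapidityField K₀), a ≠ 0 → (Polynomial.C a * Polynomial.X + Polynomial.C b) ≠ 0 ∧
      (Polynomial.C a * Polynomial.X + Polynomial.C b).natDegree = 1 := fun a b ha =>
    ⟨fun h => by have := congrArg (Polynomial.coeff · 1) h; simp [ha] at this, Polynomial.natDegree_linear ha⟩
  rcases Nat.lt_or_ge r 2 with hr2 | hr2
  · rw [if_pos (show r ≤ 1 by omega)]
    rcases Nat.lt_or_ge r 1 with hr1 | hr1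
    · -- `r = 0`
      have hr0 : r = 0 := by omega
      subst hr0
      rw [if_neg (show (0 : ℕ) ≠ 1 by omega)] at hr
      by_cases hk1 : k = 1
      · subst hk1
        rw [if_pos rfl] at hk
        rw [map_sub, hk, hr, map_sub, map_mul, rapUni_X_self, rapUni_X_of_ne (show u + 1 ≠ u by omega), add_zero,
          rapUni_X_self,
          show (Polynomial.X * Polynomial.C (genZ K₀ (u + 1)) - Polynomial.X : Polynomial (RapidityField K₀)) =
            Polynomial.C (genZ K₀ (u + 1) - 1) * Polynomial.X + Polynomial.C 0 by rw [map_sub, map_one, map_zero]; ring]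
        exact coeff1 _ _ (sub_ne_zero.2 (genZ_ne_one _))
      · rw [if_neg hk1] at hk
        rw [map_sub, hk, hr, map_sub, add_zero, rapUni_X_self, rapUni_X_of_ne (show u + k ≠ u by omega),
          show (Polynomial.C (genZ K₀ (u + k)) - Polynomial.X : Polynomial (RapidityField K₀)) =
            Polynomial.C (-1) * Polynomial.X + Polynomial.C (genZ K₀ (u + k)) by rw [map_neg, map_one]; ring]
        exact coeff1 _ _ (neg_ne_zero.2 one_ne_zero)
    · -- `r = 1`
      have hr1' : r = 1 := by omega
      subst hr1'
      rw [if_pos rfl] at hr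
      rw [if_neg (show k ≠ 1 by omega)] at hk
      rw [map_sub, hk, hr, map_sub, map_mul, rapUni_X_self, rapUni_X_of_ne (show u + 1 ≠ u by omega),
        rapUni_X_of_ne (show u + k ≠ u by omega),
        show (Polynomial.C (genZ K₀ (u + k)) - Polynomial.X * Polynomial.C (genZ K₀ (u + 1)) : Polynomial (RapidityField K₀))
          = Polynomial.C (-genZ K₀ (u + 1)) * Polynomial.X + Polynomial.C (genZ K₀ (u + k)) by rw [map_neg]; ring]
      exact coeff1 _ _ (neg_ne_zero.2 hz1)
  · rw [if_neg (show ¬r ≤ 1 by omega)]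
    rw [if_neg (show k ≠ 1 by omega)] at hk
    rw [if_neg (show r ≠ 1 by omega)] at hr
    rw [map_sub, hk, hr, map_sub, rapUni_X_of_ne (show u + k ≠ u by omega), rapUni_X_of_ne (show u + r ≠ u by omega),
      ← map_sub, Polynomial.natDegree_C]
    refine ⟨fun h => ?_, rfl⟩
    have h1 : genZ K₀ (u + k) - genZ K₀ (u + r) = 0 := Polynomial.C_eq_zero.1 h
    have h2 : (X (u + k) : MvPolynomial ℕ K₀) - X (u + r) = 0 := toRF_injective (by rw [map_sub, map_zero]; exact h1)
    exact X_sub_X_ne_zero (K := K₀) (show u + k ≠ u + r by omega) h2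

/-- **The `(x_u, x_{u+1})` pair degree of the Vandermonde alternant is `2L - 3`** (here `2L + 1` for
`L + 2` variables). [folklore] -/
theorem pairDeg_xAlt_succ (u L : ℕ) : pairDeg u (u + 1) (xAlt K₀ u (L + 2) (· + 1)) = 2 * L + 1 := by
  rw [← degreeOf_pairMap (show u ≠ u + 1 by omega), degreeOf_eq_natDegree_rapUni, xAlt_succ, map_prod, map_prod]
  have hinner : ∀ r : Fin (L + 2), (rapUni K₀ u (pairMap K₀ u (u + 1) (∏ k ∈ Finset.Ioi r, (X (u + k) - X (u + r))))) ≠ 0 ∧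
      (rapUni K₀ u (pairMap K₀ u (u + 1) (∏ k ∈ Finset.Ioi r, (X (u + k) - X (u + r))))).natDegree =
        if (r : ℕ) ≤ 1 then (Finset.Ioi r).card else 0 := fun r => by
    rw [map_prod, map_prod]
    have hf : ∀ k ∈ Finset.Ioi r, rapUni K₀ u (pairMap K₀ u (u + 1) (X (u + k) - X (u + r))) ≠ 0 := fun k hk =>
      (natDegree_rapUni_pairMap_factor u (Fin.lt_def.1 (Finset.mem_Ioi.1 hk))).1
    refine ⟨Finset.prod_ne_zero_iff.2 hf, ?_⟩
    rw [Polynomial.natDegree_prod _ _ hf, Finset.sum_congr rfl fun k hk =>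
      (natDegree_rapUni_pairMap_factor (K₀ := K₀) u (Fin.lt_def.1 (Finset.mem_Ioi.1 hk))).2, Finset.sum_const, smul_eq_mul]
    split_ifs <;> simp
  rw [Polynomial.natDegree_prod _ _ fun r _ => (hinner r).1, Finset.sum_congr rfl fun r _ => (hinner r).2,
    Fin.sum_univ_succ, Fin.sum_univ_succ, Finset.sum_eq_zero fun r _ => ?_]
  · simp only [Fin.val_zero, zero_le_one, ↓reduceIte, Fin.val_succ, le_refl, add_zero, Fin.card_Ioi]
    omega
  · rw [if_neg (by simp [Fin.val_succ])]

/-- **The pair bound of `S_L`**: the `(x_u, x_{u+1})` pair sums of `S_{L+2}` are `≤ L`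
(`= ipMu (L+1) + ipMu L - 2 - (2L + 1)`). [cite: IkhlefPonsaing2012, Def. 3.4] -/
theorem pairDeg_spS_le [CharZero K₀] (u L : ℕ) : pairDeg u (u + 1) (spS K₀ u (L + 2)) ≤ L := by
  have hid := congrArg (pairDeg u (u + 1)) (xAlt_ipMu_eq (K := K₀) u (L + 2))
  rw [pairDeg_mul (show u ≠ u + 1 by omega) (xAlt_succ_ne_zero u (L + 2)) (spS_ne_zero u (L + 2)), pairDeg_xAlt_succ] at hid
  have hA := pairDeg_xAlt_le (K₀ := K₀) u L (e := fun k => ipMu k) (fun k l h => by unfold ipMu; omega)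
  rw [hid] at hA
  unfold ipMu at hA
  omega

end SPair

/-! ### `χ̂_L = uTransfer (S_L)`: IP12's character as a polynomial in `U = z²`, and its wheel data -/

section UChar

open MvPolynomial Literature.Combinatorics.Enumerative

variable {K₀ : Type*} [Field K₀] [CharZero K₀]

variable (K₀) in
/-- **`χ̂_L(U_u, …, U_{u+L-1}) := ∏ U_n^{a_L} · S_L(U + U⁻¹)`**, `a_L = ⌊(L-1)/2⌋`: the numerator of
`χ_L(z_u², …)` in IP12's normalisation, as a polynomial in `U_n = z_n²`. [cite: IkhlefPonsaing2012, Def. 3.4, Prop. 3.4] -/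
noncomputable def uChar (u L : ℕ) : MvPolynomial ℕ K₀ := uTransfer K₀ u L ((L - 1) / 2) (spS K₀ u L)

/-- Window degrees of `S_L`. [folklore] -/
theorem spS_degreeOf_window (u L : ℕ) : ∀ n ∈ Finset.Ico u (u + L), (spS K₀ u L).degreeOf n ≤ (L - 1) / 2 :=
  fun n _ => degreeOf_spS_le u L n

/-- `S_L` has no variable outside the window. [folklore] -/
theorem spS_degreeOf_off (u L : ℕ) : ∀ n ∉ Finset.Ico u (u + L), (spS K₀ u L).degreeOf n = 0 :=
  fun n hn => degreeOf_spS_eq_zero u L (by simp only [Finset.mem_Ico, not_and, not_lt] at hn; omega)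

/-- **`χ̂_L` through a homomorphism into a field.** [folklore] -/
theorem hom_uChar {S : Type*} [Field S] (φ : MvPolynomial ℕ K₀ →+* S) {u L : ℕ}
    (hφ : ∀ n ∈ Finset.Ico u (u + L), φ (X n) ≠ 0) :
    φ (uChar K₀ u L) = (∏ n ∈ Finset.Ico u (u + L), φ (X n) ^ ((L - 1) / 2)) *
      eval₂ (φ.comp C) (fun n => φ (X n) + (φ (X n))⁻¹) (spS K₀ u L) :=
  hom_uTransfer φ hφ (spS_degreeOf_window u L) (spS_degreeOf_off u L)

/-- Degrees of `χ̂_L`: `≤ 2 a_L` on the window, `0` outside. [folklore] -/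
theorem degreeOf_uChar_le (u L n : ℕ) :
    (uChar K₀ u L).degreeOf n ≤ if n ∈ Finset.Ico u (u + L) then 2 * ((L - 1) / 2) else 0 := by
  refine (degreeOf_uTransfer_le (spS_degreeOf_window u L) (spS_degreeOf_off u L) n).trans ?_
  split_ifs with h
  · have := degreeOf_spS_le (K₀ := K₀) u L n; omega
  · exact le_rfl

omit [CharZero K₀] in
/-- `χ̂_L` is symmetric under the window transpositions. [folklore] -/
theorem rename_swap_uChar (u L : ℕ) {c d : ℕ} (hc : c ∈ Finset.Ico u (u + L)) (hd : d ∈ Finset.Ico u (u + L)) :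
    rename (Equiv.swap c d) (uChar K₀ u L) = uChar K₀ u L := by
  rw [uChar, rename_swap_uTransfer hc hd, rename_swap_spS' u L (Finset.mem_Ico.1 hc).1 (Finset.mem_Ico.1 hc).2
    (Finset.mem_Ico.1 hd).1 (Finset.mem_Ico.1 hd).2]

/-- `χ̂_L` is palindromic of formal degree `2 a_L` (field form). [folklore] -/
theorem genInv_uChar (u L : ℕ) {n : ℕ} (hn : n ∈ Finset.Ico u (u + L)) :
    genInv K₀ n (toRF K₀ (uChar K₀ u L)) * genZ K₀ n ^ (2 * ((L - 1) / 2)) = toRF K₀ (uChar K₀ u L) :=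
  genInv_uTransfer (spS_degreeOf_window u L) (spS_degreeOf_off u L) hn

/-- The `(U_u, U_{u+1})` pair sums of `χ̂_L` are `≤ 2 a_L + (L - 2)`. [folklore] -/
theorem pair_uChar (u L : ℕ) : ∀ s ∈ (uChar K₀ u L).support, s u + s (u + 1) ≤ 2 * ((L - 1) / 2) + (L - 2) := by
  intro s hs
  rcases Nat.lt_or_ge L 2 with hL | hL
  · -- `u + 1` is off the window
    have h1 : s (u + 1) = 0 := by
      have := (monomial_le_degreeOf (u + 1) hs).trans (degreeOf_uChar_le (K₀ := K₀) u L (u + 1))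
      rw [if_neg (by simp; omega)] at this
      omega
    have h2 := (monomial_le_degreeOf u hs).trans (degreeOf_uChar_le (K₀ := K₀) u L u)
    split_ifs at h2 <;> omega
  · obtain ⟨L', rfl⟩ : ∃ L', L = L' + 2 := ⟨L - 2, by omega⟩
    have := (le_pairDeg (a := u) (b := u + 1) hs).trans
      (pairDeg_uTransfer_le (spS_degreeOf_window u (L' + 2)) (spS_degreeOf_off u (L' + 2)) u (u + 1))
    have hS := pairDeg_spS_le (K₀ := K₀) u L'
    simp only [Nat.add_sub_cancel] at this ⊢
    omega

omit [CharZero K₀] in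
/-- Evaluations agree when they agree on the variables that occur. [folklore] -/
theorem eval_eq_of_degreeOf {x y : ℕ → K₀} (F : MvPolynomial ℕ K₀) (h : ∀ n, F.degreeOf n ≠ 0 → x n = y n) :
    eval x F = eval y F := by
  refine hom_congr_vars (f₁ := eval x) (f₂ := eval y) (by ext a; simp) (fun n hn _ => ?_) rfl
  simp only [eval_X]
  refine h n fun h0 => ?_
  obtain ⟨d, hd, hnd⟩ := (mem_vars_iff_mem_support n).1 hn
  have := monomial_le_degreeOf n hd
  rw [h0] at this
  exact (Finsupp.mem_support_iff.1 hnd) (Nat.eq_zero_of_le_zero this)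

/-- **The homogeneous value `χ̂_L(1, …, 1) = S_L(2, …, 2) = ipSpDim L`** (`= dim Sp(2a)` of the IP12
highest weight, the Laurent character `χ_L(1⃗)`). [cite: IkhlefPonsaing2012, Prop. 4.7] -/
theorem eval_one_uChar [Algebra ℝ K₀] (u L : ℕ) : eval (fun _ => (1 : K₀)) (uChar K₀ u L) = ((ipSpDim L : ℚ) : K₀) := by
  have h := hom_uChar (eval fun _ => (1 : K₀)) (u := u) (L := L) (fun n _ => by rw [eval_X]; exact one_ne_zero)
  simp only [eval_X, inv_one, one_pow, Finset.prod_const_one, one_mul] at h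
  rw [h, show (eval fun _ => (1 : K₀)).comp C = RingHom.id K₀ from RingHom.ext fun a => eval_C _,
    show eval₂ (RingHom.id K₀) (fun _ => (1 : K₀) + 1) (spS K₀ u L) = eval (fun _ => (1 : K₀) + 1) (spS K₀ u L) from rfl,
    ← eval_two_spS (algebraMap ℝ K₀) u L]
  refine eval_eq_of_degreeOf _ fun n hn => ?_
  have hw : u ≤ n ∧ n < u + L := by
    by_contra h'
    exact hn (spS_degreeOf_off u L n (by simpa [Finset.mem_Ico] using h'))
  simp only [Function.comp_apply, xPt, dif_pos hw, inv_one, map_add, map_one]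

/-- **`χ̂_L ≠ 0`.** [folklore] -/
theorem uChar_ne_zero [Algebra ℝ K₀] (u L : ℕ) : uChar K₀ u L ≠ 0 := fun h => by
  have := eval_one_uChar (K₀ := K₀) u L
  rw [h, map_zero] at this
  have h2 : (ipSpDim L : ℚ) ≠ 0 := by exact_mod_cast (ipSpDim_pos L).ne'
  exact h2 (by exact_mod_cast this.symm)

end UChar

/-! ### The wheel condition for `χ̂_L` -/

section UCharWheel

open MvPolynomial Literature.Combinatorics.Enumerative

variable {K₀ : Type*} [Field K₀]

/-- The `x`-alternant through `eval₂Hom` into the rapidity field. [folklore] -/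
theorem eval₂Hom_xAlt (g : ℕ → RapidityField K₀) (u L : ℕ) (e : ℕ → ℕ) :
    eval₂Hom ((toRF K₀).comp C) g (xAlt K₀ u L e) =
      (Matrix.of fun i k : Fin L => (chebE (RapidityField K₀) (e k - 1)).eval (g (u + i))).det := by
  rw [xAlt, RingHom.map_det]
  congr 1
  ext i k
  simp only [RingHom.mapMatrix_apply, Matrix.map_apply, xAltMat, Matrix.of_apply, xE]
  rw [Polynomial.aeval_def, MvPolynomial.algebraMap_eq, Polynomial.hom_eval₂, eval₂Hom_X', ← chebE_map ((toRF K₀).comp C),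
    Polynomial.eval_map, eval₂Hom_comp_C]

/-- `1 + ω^μ + ω^{2μ} = 0` for `3 ∤ μ`. [folklore] -/
theorem one_add_pow_add_pow_eq_zero {ω : K₀} (hω : ω ^ 2 + ω + 1 = 0) {μ : ℕ} (hμ : μ % 3 ≠ 0) :
    1 + ω ^ μ + ω ^ (2 * μ) = 0 := by
  have h3 := IsWheelPoly.cube_eq_one hω
  have hred : ∀ n, ω ^ n = ω ^ (n % 3) := fun n => by
    conv_lhs => rw [← Nat.div_add_mod n 3, pow_add, pow_mul, h3, one_pow, one_mul]
  rw [hred μ, hred (2 * μ)]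
  have : μ % 3 = 1 ∨ μ % 3 = 2 := by omega
  rcases this with h | h
  · rw [h, show 2 * μ % 3 = 2 by omega]; linear_combination hω
  · rw [h, show 2 * μ % 3 = 1 by omega]; linear_combination hω

/-- `C c · X_i = C c' · X_j` with `c ≠ 0` forces `c = c'` and `i = j` (rapidity-field form). [folklore] -/
theorem genC_mul_genZ_eq_iff {c c' : K₀} (hc : c ≠ 0) {i j : ℕ} (h : genC K₀ c * genZ K₀ i = genC K₀ c' * genZ K₀ j) :
    c = c' ∧ i = j := by
  classical
  have h1 : (C c * X i : MvPolynomial ℕ K₀) = C c' * X j := toRF_injective (by rw [map_mul, map_mul]; exact h)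
  have h2 := congrArg (coeff (Finsupp.single i 1)) h1
  rw [coeff_C_mul, coeff_C_mul, coeff_X_same, coeff_X, mul_one] at h2
  by_cases hij : Finsupp.single j 1 = Finsupp.single i 1
  · rw [if_pos hij, mul_one] at h2
    exact ⟨h2, ((Finsupp.single_left_inj one_ne_zero).1 hij).symm⟩
  · rw [if_neg hij, mul_zero] at h2; exact absurd h2 hc

/-- A product of two scaled rapidities is never `1`. [folklore] -/
theorem genC_mul_genZ_mul_ne_one (c c' : K₀) (i j : ℕ) : genC K₀ c * genZ K₀ i * (genC K₀ c' * genZ K₀ j) ≠ 1 := by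
  intro h
  have h1 : (C (c * c') * (X i * X j) : MvPolynomial ℕ K₀) = 1 :=
    toRF_injective (by rw [map_mul, map_mul, map_one, map_mul, map_mul, ← h]; simp only [genC, genZ]; ring)
  by_cases hcc : c * c' = 0
  · rw [hcc, C_0, zero_mul] at h1; exact one_ne_zero h1.symm
  · have h2 := congrArg (degreeOf i) h1
    rw [degreeOf_one, degreeOf_mul_eq (C_ne_zero.2 hcc) (mul_ne_zero (X_ne_zero _) (X_ne_zero _)), degreeOf_C,
      degreeOf_mul_eq (X_ne_zero _) (X_ne_zero _), degreeOf_X, if_pos rfl] at h2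
    omega

/-- **The wheel point**: the images of the `U_n` under `U_{u+1} ↦ ω U_u`, `U_k ↦ ω² U_u`. [folklore] -/
noncomputable def wPt (ω : K₀) (u k : ℕ) : ℕ → RapidityField K₀ :=
  fun n => genC K₀ (if n = u + 1 then ω else if n = k then ω ^ 2 else 1) * genZ K₀ (if n = u + 1 ∨ n = k then u else n)

/-- The three forms of the wheel point. [folklore] -/
theorem wPt_trichotomy (ω : K₀) (u k : ℕ) (n : ℕ) :
    (n = u + 1 ∧ wPt ω u k n = genC K₀ ω * genZ K₀ u) ∨ (n = k ∧ wPt ω u k n = genC K₀ (ω ^ 2) * genZ K₀ u) ∨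
      (n ≠ u + 1 ∧ n ≠ k ∧ wPt ω u k n = genC K₀ 1 * genZ K₀ n) := by
  unfold wPt
  by_cases h1 : n = u + 1
  · exact Or.inl ⟨h1, by rw [if_pos h1, if_pos (Or.inl h1)]⟩
  · by_cases h2 : n = k
    · exact Or.inr (Or.inl ⟨h2, by rw [if_neg h1, if_pos h2, if_pos (Or.inr h2)]⟩)
    · exact Or.inr (Or.inr ⟨h1, h2, by rw [if_neg h1, if_neg h2, if_neg (by tauto)]⟩)

/-- The wheel point is the image of the generators under `toRF ∘ wheelSub`. [folklore] -/
theorem toRF_wheelSub_X (ω : K₀) {u k : ℕ} (hk : u + 2 ≤ k) (n : ℕ) :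
    toRF K₀ (wheelSub K₀ ω u (u + 1) k (X n)) = wPt ω u k n := by
  rw [wheelSub_X ω (show u ≠ u + 1 by omega) (show u + 1 ≠ k by omega) (show u ≠ k by omega)]
  rcases wPt_trichotomy ω u k n with ⟨h1, e⟩ | ⟨h2, e⟩ | ⟨h1, h2, e⟩
  · rw [e, if_pos h1, map_mul]; rfl
  · rw [e, if_neg (by omega), if_pos h2, map_mul]; rfl
  · rw [e, if_neg h1, if_neg h2, show genC K₀ 1 = 1 from map_one _, one_mul]; rfl

/-- The wheel point has nonzero coordinates. [folklore] -/
theorem wPt_ne_zero {ω : K₀} (hω0 : ω ≠ 0) (u k : ℕ) (n : ℕ) : wPt ω u k n ≠ 0 := by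
  have hC : ∀ c : K₀, c ≠ 0 → genC K₀ c ≠ 0 := fun c hc h =>
    hc ((C_eq_zero (σ := ℕ)).1 (toRF_injective (h.trans (map_zero _).symm)))
  rcases wPt_trichotomy ω u k n with ⟨-, e⟩ | ⟨-, e⟩ | ⟨-, -, e⟩ <;> rw [e]
  · exact mul_ne_zero (hC _ hω0) (genZ_ne_zero _)
  · exact mul_ne_zero (hC _ (pow_ne_zero 2 hω0)) (genZ_ne_zero _)
  · exact mul_ne_zero (hC _ one_ne_zero) (genZ_ne_zero _)

/-- **The coordinates of the wheel point are pairwise distinct and never mutually inverse**, so the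
values `w + w⁻¹` are pairwise distinct. [folklore] -/
theorem wPt_sub_ne_zero {ω : K₀} (hω : ω ^ 2 + ω + 1 = 0) (hω1 : ω ≠ 1) (u k : ℕ) {a b : ℕ} (hab : a ≠ b) :
    wPt ω u k a + (wPt ω u k a)⁻¹ - (wPt ω u k b + (wPt ω u k b)⁻¹) ≠ 0 := by
  have hω0 := IsWheelPoly.omega_ne_zero hω
  have hωsq := IsWheelPoly.omega_ne_sq hω hω1
  have hω21 : ω ^ 2 ≠ 1 := fun h => hω1 (by
    have h3 := IsWheelPoly.cube_eq_one hω
    calc ω = ω ^ 3 * (ω ^ 2)⁻¹ := by rw [pow_succ, h, one_mul, inv_one, mul_one]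
      _ = 1 := by rw [h3, h, inv_one, mul_one])
  have ha0 := wPt_ne_zero hω0 u k a
  have hb0 := wPt_ne_zero hω0 u k b
  have key : wPt ω u k a + (wPt ω u k a)⁻¹ - (wPt ω u k b + (wPt ω u k b)⁻¹) =
      (wPt ω u k a - wPt ω u k b) * (1 - (wPt ω u k a * wPt ω u k b)⁻¹) := by
    field_simp; ring
  rw [key]
  refine mul_ne_zero (sub_ne_zero.2 fun h => ?_) (sub_ne_zero.2 fun h => ?_)
  · rcases wPt_trichotomy ω u k a with ⟨ha, ea⟩ | ⟨ha, ea⟩ | ⟨ha1, ha2, ea⟩ <;>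
      rcases wPt_trichotomy ω u k b with ⟨hb, eb⟩ | ⟨hb, eb⟩ | ⟨hb1, hb2, eb⟩ <;> rw [ea, eb] at h
    · exact hab (ha.trans hb.symm)
    · exact hωsq (genC_mul_genZ_eq_iff hω0 h).1
    · exact hω1 (genC_mul_genZ_eq_iff hω0 h).1
    · exact hωsq (genC_mul_genZ_eq_iff (pow_ne_zero 2 hω0) h).1.symm
    · exact hab (ha.trans hb.symm)
    · exact hω21 (genC_mul_genZ_eq_iff (pow_ne_zero 2 hω0) h).1
    · exact hω1 (genC_mul_genZ_eq_iff one_ne_zero h).1.symm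
    · exact hω21 (genC_mul_genZ_eq_iff one_ne_zero h).1.symm
    · exact hab (genC_mul_genZ_eq_iff one_ne_zero h).2
  · unfold wPt at h
    exact genC_mul_genZ_mul_ne_one _ _ _ _ (inv_eq_one.1 h.symm)

/-- **The alternant of IP12's highest weights vanishes at the wheel point** `x_n = w_n + w_n⁻¹`:
the rows `u, u+1, k`, weighted by `w - w⁻¹`, sum to `(w^μ(1+ω^μ+ω^{2μ}) - …)_μ = 0` since `3 ∤ ipMu`.
[cite: IkhlefPonsaing2012, (26)] -/
theorem eval₂Hom_xAlt_ipMu_wheel_eq_zero {ω : K₀} (hω : ω ^ 2 + ω + 1 = 0) {u L k : ℕ} (hk : u + 2 ≤ k) (hkL : k < u + L) :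
    eval₂Hom ((toRF K₀).comp C) (fun n => wPt ω u k n + (wPt ω u k n)⁻¹) (xAlt K₀ u L fun c => ipMu c) = 0 := by
  classical
  have hω0 := IsWheelPoly.omega_ne_zero hω
  rw [eval₂Hom_xAlt]
  set M : Matrix (Fin L) (Fin L) (RapidityField K₀) :=
    Matrix.of fun i c : Fin L => (chebE (RapidityField K₀) (ipMu c - 1)).eval (wPt ω u k (u + i) + (wPt ω u k (u + i))⁻¹) with hM
  -- the three rows and their weights
  set i₀ : Fin L := ⟨0, by omega⟩
  set i₁ : Fin L := ⟨1, by omega⟩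
  set i₂ : Fin L := ⟨k - u, by omega⟩
  set T : Finset (Fin L) := {i₀, i₁, i₂} with hT
  set v : Fin L → RapidityField K₀ := fun i => if i ∈ T then wPt ω u k (u + i) - (wPt ω u k (u + i))⁻¹ else 0 with hv
  have h01 : i₀ ≠ i₁ := by simp [i₀, i₁, Fin.ext_iff]
  have h02 : i₀ ≠ i₂ := by simp [i₀, i₂, Fin.ext_iff]; omega
  have h12 : i₁ ≠ i₂ := by simp [i₁, i₂, Fin.ext_iff]; omega
  -- the three coordinates
  have hw0 : wPt ω u k (u + (i₀ : ℕ)) = genZ K₀ u := by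
    rcases wPt_trichotomy ω u k (u + (i₀ : ℕ)) with ⟨h, -⟩ | ⟨h, -⟩ | ⟨-, -, e⟩
    · simp [i₀] at h
    · simp [i₀] at h; omega
    · rw [e, show genC K₀ 1 = 1 from map_one _, one_mul]; simp [i₀]
  have hw1 : wPt ω u k (u + (i₁ : ℕ)) = genC K₀ ω * genZ K₀ u := by
    rcases wPt_trichotomy ω u k (u + (i₁ : ℕ)) with ⟨-, e⟩ | ⟨h, -⟩ | ⟨h, -, -⟩
    · exact e
    · simp [i₁] at h; omega
    · simp [i₁] at h
  have hw2 : wPt ω u k (u + (i₂ : ℕ)) = genC K₀ (ω ^ 2) * genZ K₀ u := by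
    have : u + (i₂ : ℕ) = k := by simp [i₂]; omega
    rcases wPt_trichotomy ω u k (u + (i₂ : ℕ)) with ⟨h, -⟩ | ⟨-, e⟩ | ⟨-, h, -⟩
    · omega
    · exact e
    · exact absurd this h
  -- `v ᵥ* M = 0`
  have hvM : Matrix.vecMul v M = 0 := by
    ext c
    change ∑ i, v i * M i c = 0
    have hsupp : ∀ i ∉ T, v i * M i c = 0 := fun i hi => by rw [hv]; simp only; rw [if_neg hi, zero_mul]
    rw [← Finset.sum_subset (Finset.subset_univ T) (fun i _ hi => hsupp i hi), hT,
      Finset.sum_insert (by simp [h01, h02]), Finset.sum_insert (by simp [h12]), Finset.sum_singleton]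
    have hterm : ∀ i ∈ T, v i * M i c = wPt ω u k (u + i) ^ ipMu c - (wPt ω u k (u + i))⁻¹ ^ ipMu c := fun i hi => by
      rw [hv, hM]; simp only [Matrix.of_apply]; rw [if_pos hi]
      have := chebE_eval (wPt_ne_zero hω0 u k (u + i)) (ipMu c - 1)
      rwa [show ipMu c - 1 + 1 = ipMu c by unfold ipMu; omega] at this
    rw [hterm i₀ (by simp [hT]), hterm i₁ (by simp [hT]), hterm i₂ (by simp [hT]), hw0, hw1, hw2]
    have hμ : ipMu c % 3 ≠ 0 := by unfold ipMu; omega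
    have hωinv : (ω⁻¹) ^ 2 + ω⁻¹ + 1 = 0 := by
      field_simp
      linear_combination hω
    have e1 := one_add_pow_add_pow_eq_zero hω hμ
    have e2 := one_add_pow_add_pow_eq_zero hωinv hμ
    have hz := genZ_ne_zero (K₀ := K₀) u
    have hgC : ∀ a : K₀, genC K₀ a = ((toRF K₀).comp C) a := fun a => rfl
    -- collect
    have key : genZ K₀ u ^ ipMu c - (genZ K₀ u)⁻¹ ^ ipMu c +
        ((genC K₀ ω * genZ K₀ u) ^ ipMu c - (genC K₀ ω * genZ K₀ u)⁻¹ ^ ipMu c +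
          ((genC K₀ (ω ^ 2) * genZ K₀ u) ^ ipMu c - (genC K₀ (ω ^ 2) * genZ K₀ u)⁻¹ ^ ipMu c)) =
        genZ K₀ u ^ ipMu c * genC K₀ (1 + ω ^ ipMu c + ω ^ (2 * ipMu c)) -
          (genZ K₀ u)⁻¹ ^ ipMu c * genC K₀ (1 + ω⁻¹ ^ ipMu c + ω⁻¹ ^ (2 * ipMu c)) := by
      simp only [hgC, map_add, map_one, map_pow, map_inv₀, mul_inv, mul_pow, pow_mul, ← inv_pow]
      ring
    rw [key, e1, e2]
    simp [hgC]
  have hv0 : v ≠ 0 := fun h => by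
    have := congrFun h i₀
    rw [hv] at this
    simp only [Pi.zero_apply] at this
    rw [if_pos (by simp [hT]), hw0, sub_eq_zero] at this
    have hsq : genZ K₀ u * genZ K₀ u = 1 := by
      nth_rw 2 [this]
      exact mul_inv_cancel₀ (genZ_ne_zero u)
    have := genC_mul_genZ_mul_ne_one (K₀ := K₀) 1 1 u u
    rw [show genC K₀ 1 = 1 from map_one _, one_mul] at this
    exact this hsq
  exact Matrix.exists_vecMul_eq_zero_iff.1 ⟨v, hv0, hvM⟩

/-- **`S_L` vanishes at the wheel point** (`L ≥ 3`, third index `k` in the window): the alternant does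
and the Vandermonde denominator does not. [cite: IkhlefPonsaing2012, (26)] -/
theorem eval₂Hom_spS_wheel_eq_zero {ω : K₀} (hω : ω ^ 2 + ω + 1 = 0) (hω1 : ω ≠ 1) {u L k : ℕ} (hk : u + 2 ≤ k)
    (hkL : k < u + L) :
    eval₂Hom ((toRF K₀).comp C) (fun n => wPt ω u k n + (wPt ω u k n)⁻¹) (spS K₀ u L) = 0 := by
  have hid := congrArg (eval₂Hom ((toRF K₀).comp C) (fun n => wPt ω u k n + (wPt ω u k n)⁻¹)) (xAlt_ipMu_eq (K := K₀) u L)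
  rw [map_mul, eval₂Hom_xAlt_ipMu_wheel_eq_zero hω hk hkL] at hid
  refine (mul_eq_zero.1 hid.symm).resolve_left ?_
  rw [xAlt_succ, map_prod]
  refine Finset.prod_ne_zero_iff.2 fun i _ => ?_
  rw [map_prod]
  refine Finset.prod_ne_zero_iff.2 fun j hj => ?_
  rw [map_sub, eval₂Hom_X', eval₂Hom_X']
  exact wPt_sub_ne_zero hω hω1 u k (by have := Fin.lt_def.1 (Finset.mem_Ioi.1 hj); omega)

/-- **The wheel condition for `χ̂_L`** at the base triples `(u, u+1, k)`.
[cite: IkhlefPonsaing2012, (26), Prop. 3.4 (proof)] -/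
theorem wheelSub_uChar_eq_zero [CharZero K₀] {ω : K₀} (hω : ω ^ 2 + ω + 1 = 0) (hω1 : ω ≠ 1) {u L k : ℕ}
    (hk : u + 2 ≤ k) (hkL : k < u + L) : wheelSub K₀ ω u (u + 1) k (uChar K₀ u L) = 0 := by
  have hω0 := IsWheelPoly.omega_ne_zero hω
  apply toRF_injective
  rw [map_zero]
  set φ : MvPolynomial ℕ K₀ →+* RapidityField K₀ := (toRF K₀).comp (wheelSub K₀ ω u (u + 1) k).toRingHom with hφ
  have hφX : ∀ n, φ (X n) = wPt ω u k n := fun n => by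
    rw [hφ, RingHom.comp_apply, AlgHom.toRingHom_eq_coe, RingHom.coe_coe, toRF_wheelSub_X ω hk]
  have hφC : φ.comp C = (toRF K₀).comp C := by
    ext a
    · change toRF K₀ (wheelSub K₀ ω u (u + 1) k (C a)) = toRF K₀ (C a)
      rw [← MvPolynomial.algebraMap_eq, AlgHom.commutes]
  have h := hom_uChar φ (u := u) (L := L) (fun n _ => by rw [hφX]; exact wPt_ne_zero hω0 u k n)
  rw [show toRF K₀ (wheelSub K₀ ω u (u + 1) k (uChar K₀ u L)) = φ (uChar K₀ u L) from rfl, h, hφC]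
  simp only [hφX]
  rw [← coe_eval₂Hom, eval₂Hom_spS_wheel_eq_zero hω hω1 hk hkL, mul_zero]

/-- **IP12's character is a wheel polynomial**: `χ̂_L ∈ IsWheelPoly ω u L (2a_L) (2a_L + L - 2)`,
`a_L = ⌊(L-1)/2⌋` — i.e. with the parameters `(2m+1, 2m, 4m-1)` for `L = 2m+1` and `(2m+2, 2m, 4m)`
for `L = 2m+2` of the uniqueness theorems. [cite: IkhlefPonsaing2012, (26), Prop. 3.4 (proof)] -/
theorem uChar_isWheelPoly [CharZero K₀] {ω : K₀} (hω : ω ^ 2 + ω + 1 = 0) (hω1 : ω ≠ 1) (u L : ℕ) :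
    IsWheelPoly ω u L (2 * ((L - 1) / 2)) (2 * ((L - 1) / 2) + (L - 2)) (uChar K₀ u L) := by
  refine IsWheelPoly.of_base (fun n hn => ?_) (fun a b ha haL hb hbL => ?_) (fun n hn hnL => ?_) (fun n hn hnL => ?_)
    (pair_uChar u L) (fun k hk hkL => wheelSub_uChar_eq_zero hω hω1 hk hkL)
  · have := degreeOf_uChar_le (K₀ := K₀) u L n
    rw [if_neg (by simpa [Finset.mem_Ico] using hn)] at this
    exact Nat.eq_zero_of_le_zero this
  · exact rename_swap_uChar u L (Finset.mem_Ico.2 ⟨ha, haL⟩) (Finset.mem_Ico.2 ⟨hb, hbL⟩)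
  · have := degreeOf_uChar_le (K₀ := K₀) u L n
    rw [if_pos (Finset.mem_Ico.2 ⟨hn, hnL⟩)] at this
    exact this
  · exact genInv_uChar u L (Finset.mem_Ico.2 ⟨hn, hnL⟩)

/-- The odd case in the parameters of `IsWheelPoly.proportional_odd`. [cite: IkhlefPonsaing2012, Prop. 3.4] -/
theorem uChar_isWheelPoly_odd [CharZero K₀] {ω : K₀} (hω : ω ^ 2 + ω + 1 = 0) (hω1 : ω ≠ 1) (u m : ℕ) :
    IsWheelPoly ω u (2 * m + 1) (2 * m) (4 * m - 1) (uChar K₀ u (2 * m + 1)) := by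
  have h := uChar_isWheelPoly (K₀ := K₀) hω hω1 u (2 * m + 1)
  rwa [show 2 * ((2 * m + 1 - 1) / 2) = 2 * m by omega, show 2 * m + (2 * m + 1 - 2) = 4 * m - 1 by omega] at h

/-- The even case in the parameters of `IsWheelPoly.proportional_even`. [cite: IkhlefPonsaing2012, (26)] -/
theorem uChar_isWheelPoly_even [CharZero K₀] {ω : K₀} (hω : ω ^ 2 + ω + 1 = 0) (hω1 : ω ≠ 1) (u m : ℕ) :
    IsWheelPoly ω u (2 * m + 2) (2 * m) (4 * m) (uChar K₀ u (2 * m + 2)) := by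
  have h := uChar_isWheelPoly (K₀ := K₀) hω hω1 u (2 * m + 2)
  rwa [show 2 * ((2 * m + 2 - 1) / 2) = 2 * m by omega, show 2 * m + (2 * m + 2 - 2) = 4 * m by omega] at h

end UCharWheel

end Literature.Probability.Percolation
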